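import Literature.AnabelianGeometry.EtaleTheta.Discharge.Sec2InnerInducesOnTheta
import Literature.AnabelianGeometry.EtaleTheta.Discharge.Sec2ThetaOrbitTransportCalculusOfEmbedding
import Literature.AnabelianGeometry.EtaleTheta.Discharge.Sec2OrbitEmbeddingCoeff
import HarnessLib

/-!
# [EtTh] Cor 2.8 (i): INSTANCE FORMS of «equal up to multiplication by a root of unity of order `n`»
# (abc-iut-L2-t2's `ThetaOrbitData.EqUpToRootOfUnity`, FACT-LIST row F-0642) — and «order `1`» IS equality at the §1 model

S. Mochizuki, *The étale theta function and its Frobenioid-theoretic manifestations* [EtTh], Publ. RIMS **45** (2009), §2,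
Cor 2.8 (i) PRIMS PDF p.42: «`γ` preserves the property that `η̲̈^{Θ,l·ℤ×μ₂}` (resp. `η̈^{Θ,ℤ×μ₂}`; `η̲̈^{Θ,l·ℤ×μ₂}`; `η̈^{Θ,l·ℤ×μ₂}`)
be of standard type — a property that determines this collection of classes up to multiplication by a root of unity of order
`l` (resp. `1`; `l`; `1`)»; Def 2.7 p.41 (the orbit collections); (iii) p.42 («without any constant multiple indeterminacy»)
(bib key `MochizukiEtTh2009`).

PROOF-ONLY companion (0 `def`, 0 `instance`, no new `Prop`; cell abc-iut, block F, seat abc-iut-f-161 gen 8 — KEY F0642;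
node EtTh:Cor2.8(i); every input BY NAME, nothing restated).  abc-iut-L2-t2's `ThetaOrbitData.EqUpToRootOfUnity n H C C′`
(`ThetaRootOrbits`) is the PREDICATE «`C′` is the twist of `C` by an inflated `G_K`-cocycle `κ` whose class is killed by `n`»;
it occurs in `ThetaOrbitData.Cor28_i` only covariantly (conclusions C2/C3/C4).  Its universal closure over the interface is
refuted (abc-iut-f-152's `not_forall_eqUpToRootOfUnity`): the INSTANCE FORMS are the content.  This file records:
* §1 (generic, any `O : ThetaOrbitData T`) `EqUpToRootOfUnity.of_twist` — the print relation's DEFINING instance: every twist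
  by an inflated 1-cocycle `κ` with `κ^n = ∂d` is related (`κ ≠ 1` allowed); `EqUpToRootOfUnity.of_eq`; and the CONTENT lemma
  **`EqUpToRootOfUnity.eq_of_one`** — for a commutative cyclotome and a collection whose classes are `∂`-SATURATED (closed under
  multiplication by coboundaries `g ↦ (g·d·g⁻¹)·d⁻¹`), «equal up to a root of unity of ORDER `1`» IS literal equality
  `C′ = C` (print's «resp. `1`» reads «preserved exactly»);
* §2 (the §1 model `ThetaOrbitData.ofEmbedding ε hC hS` of abc-iut-L2-t2, any orbit embedding `ε`) the classes of the model —
  transported `H¹(Π^tp_Ÿ, Δ_Θ)`-classes (`OrbitEmbedding.classOf`) and their root classes — ARE `∂`-saturated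
  (`mul_coboundary_mem_classOf`, `…_of_mem_orbitColl`, `…_of_mem_rootColl`), so **at the model each of the five collections
  `η̈^{Θ,ℤ×μ₂}`, `η̈^{Θ,l·ℤ×μ₂}`, `η̈^{Θ,l·ℤ}`, `η̲̈^{Θ,l·ℤ×μ₂}`, `η̲̈^{Θ,l·ℤ}` satisfies `EqUpToRootOfUnity 1 _ C C′ ↔ C′ = C`**
  (`ofEmbedding_eqUpToRootOfUnity_one_iff_*`); in particular conclusions C3/C4 of `Cor28_i` at the model, for EVERY pair
  `(Γ, Γ_Θ)`, say EXACTLY `Γ·η̈^{Θ,ℤ×μ₂} = η̈^{Θ,ℤ×μ₂}`, `Γ·η̈^{Θ,l·ℤ×μ₂} = η̈^{Θ,l·ℤ×μ₂}` (`ofEmbedding_cor28_i_C3C4_iff_transport_eq`);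
* §3 HEAD-FORM instances at the model for every INNER `γ_x`, `x ∈ Π^tp_{X̲̲}` of `T`: the three `EqUpToRootOfUnity` conclusions of
  `Cor28_i` (orders `l`, `1`, `1`) hold — abc-iut-L2-t2's inner transports BY NAME (`κ = 1`) — with the side data (`Γ_Θ = act x`,
  stabilities of `Π^tp_Ÿ`, `Π^tp_{Ÿ̲̲}`) discharged (`ofEmbedding_exists_eqUpToRootOfUnity_innerAutTop`).
WHAT IS NOT CLAIMED: the non-inner `Γ` case of C2–C4 (theta rigidity under arbitrary automorphisms; print: Props 2.4/2.6,
Thm 1.10 (i) BY NAME) — the residual of F-0640 `Cor28_i`, untouched here.  HONEST FRAMING: instance forms at a semi-synthetic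
model = consistency / non-vacuity evidence for the TYPED predicate only; [EtTh] is refereed and nothing of it is asserted; no
side is taken on [IUTchIII] Cor 3.12; typed ≠ proved; instantiated ≠ endorsed.
-/

noncomputable section

namespace Literature.AnabelianGeometry.EtaleTheta

open Literature.AnabelianGeometry.SemiGraphs ThetaCovers

universe u

/-! ## §1. Generic: the defining instance, and «order `1`» is equality on `∂`-saturated collections -/

namespace ThetaCovers.ThetaOrbitData

section generic

variable {l : ℕ} {T : TemperedCoverData.{u} l} {O : ThetaOrbitData T}

/-- **The defining instance**: the twist of ANY collection `C` by an inflated 1-cocycle `κ` (constant on `G_K`-fibres, cocycle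
for the conjugation action on `Δ_Θ`) whose class is killed by `n` (`κ^n = ∂d`) is «equal to `C` up to multiplication by a root
of unity of order `n`» — `κ ≠ 1` allowed (a genuine `μ_n`-multiple). [cite: MochizukiEtTh2009, Cor 2.8(i) p.42] -/
theorem EqUpToRootOfUnity.of_twist {n : ℕ} (H : Subgroup T.Gtp) (C : Set (Set (↥H → O.DeltaTheta)))
    {κ : T.Gtp → O.DeltaTheta} (hinf : ∀ x y, T.aug (T.toHat x) = T.aug (T.toHat y) → κ x = κ y)
    (hcoc : ∀ x y, κ (x * y) = κ x * O.act x (κ y)) (hn : ∃ d : O.DeltaTheta, ∀ x, κ x ^ n = O.act x d * d⁻¹) :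
    O.EqUpToRootOfUnity n H C (O.twist H κ C) :=
  ⟨κ, hinf, hcoc, hn, rfl⟩

/-- Equal collections are equal up to a root of unity of every order (`κ = 1`, abc-iut-L2-t2's `eqUpToRootOfUnity_refl`).
[cite: MochizukiEtTh2009, Cor 2.8(i) p.42] -/
theorem EqUpToRootOfUnity.of_eq {n : ℕ} {H : Subgroup T.Gtp} {C C' : Set (Set (↥H → O.DeltaTheta))} (h : C' = C) :
    O.EqUpToRootOfUnity n H C C' := by
  subst h
  exact O.eqUpToRootOfUnity_refl n H C'

/-- **«Up to a root of unity of ORDER `1`» IS EQUALITY** for a commutative cyclotome and a `∂`-SATURATED collection (every class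
`c ∈ C` is closed under multiplication by the coboundaries `g ↦ (g·d·g⁻¹)·d⁻¹`, `d ∈ Δ_Θ` — true of genuine cohomology classes
carried as their sets of cocycles): a witness `κ` with `κ^1 = ∂d` IS a coboundary, and twisting a `∂`-saturated class by a
coboundary returns the class.  Print's «resp. `1`» cases of Cor 2.8 (i) thus read «`γ` preserves the collection EXACTLY».
[cite: MochizukiEtTh2009, Cor 2.8(i) p.42] -/
theorem EqUpToRootOfUnity.eq_of_one (hcomm : ∀ a b : O.DeltaTheta, a * b = b * a) {H : Subgroup T.Gtp}
    {C C' : Set (Set (↥H → O.DeltaTheta))}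
    (hsat : ∀ c ∈ C, ∀ η ∈ c, ∀ d : O.DeltaTheta, (fun g : ↥H => η g * (O.act (g : T.Gtp) d * d⁻¹)) ∈ c)
    (h : O.EqUpToRootOfUnity 1 H C C') : C' = C := by
  obtain ⟨κ, -, -, ⟨d, hd⟩, rfl⟩ := h
  simp only [pow_one] at hd
  unfold ThetaOrbitData.twist
  refine Set.EqOn.image_eq_self fun c hc => ?_
  show (fun η : ↥H → O.DeltaTheta => fun g => η g * κ g) '' c = c
  apply Set.Subset.antisymm
  · rintro _ ⟨η, hη, rfl⟩
    have hfun : (fun g : ↥H => η g * κ g) = fun g => η g * (O.act (g : T.Gtp) d * d⁻¹) := by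
      funext g
      rw [hd]
    show (fun g : ↥H => η g * κ g) ∈ c
    rw [hfun]
    exact hsat c hc η hη d
  · intro η hη
    refine ⟨fun g => η g * (O.act (g : T.Gtp) d⁻¹ * (d⁻¹)⁻¹), hsat c hc η hη d⁻¹, ?_⟩
    funext g
    show η g * (O.act (g : T.Gtp) d⁻¹ * (d⁻¹)⁻¹) * κ g = η g
    rw [hd, map_inv, inv_inv, mul_assoc,
      show (O.act (g : T.Gtp) d)⁻¹ * d * (O.act (g : T.Gtp) d * d⁻¹) = 1 by
        rw [hcomm (O.act _ d) d⁻¹, mul_assoc, ← mul_assoc d, mul_inv_cancel, one_mul, inv_mul_cancel],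
      mul_one]

end generic

end ThetaCovers.ThetaOrbitData

/-! ## §2. At the §1 model `ofEmbedding`: classes are `∂`-saturated; «order `1`» ⟺ equality -/

namespace ThetaSetting.EtaleThetaData.DoubleUnderline.OrbitEmbedding

variable {p : ℕ} [Fact p.Prime] {D : ThetaSetting p} {E : D.EtaleThetaData} {l : ℕ}
  {C : E.DoubleUnderline l} {T : TemperedCoverData.{u} l} (ε : C.OrbitEmbedding T)

/-- **Transported classes are `∂`-saturated**: if `F ∈ classOf x` (the transport of a cocycle representative `f` of
`x ∈ H¹(Π^tp_Ÿ, Δ_Θ)`), then so is `F · ∂d` for every `d` in the cyclotome `top/bot` of `ofEmbedding` — it is the transport of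
the representative `f · ∂d₀` (`d = coeffOf d₀`; `coeffOf` multiplicative and `act`-equivariant, abc-iut-L2-t2).
[cite: MochizukiEtTh2009, Def 2.7 p.41] -/
theorem mul_coboundary_mem_classOf (hC : D.Compat) (hS : D.Sec2Hyps) {x : D.H1 D.GtpYdd}
    {F : ↥T.PiYddtp → (ThetaOrbitData.ofEmbedding ε hC hS).DeltaTheta} (hF : F ∈ ε.classOf x)
    (d : (ThetaOrbitData.ofEmbedding ε hC hS).DeltaTheta) :
    (fun g : ↥T.PiYddtp => F g * ((ThetaOrbitData.ofEmbedding ε hC hS).act (g : T.Gtp) d * d⁻¹)) ∈ ε.classOf x := by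
  haveI : ε.bot.Normal := ε.normal_bot
  obtain ⟨f, hfx, rfl⟩ := hF
  obtain ⟨d₀, rfl⟩ := ε.coeffOf_surjective d
  have hinv : ε.coeffOf d₀⁻¹ = (ε.coeffOf d₀)⁻¹ := by
    obtain ⟨e, he⟩ := ε.exists_mulEquiv_coeffOf
    rw [← he, ← he, map_inv]
  let c : ↥(contCocycles D.toTheta D.DeltaTheta D.GtpYdd) :=
    ⟨fun h : ↥D.GtpYdd => MulAut.conjNormal (D.toTheta (h : D.PiTemp)) d₀ * d₀⁻¹,
      coboundary_mem_contCocycles d₀ D.GtpYdd⟩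
  refine ⟨f * c, ?_, ?_⟩
  · rw [← hfx]
    change (QuotientGroup.mk (f * c) : D.H1 D.GtpYdd) = QuotientGroup.mk f
    rw [QuotientGroup.mk_mul, (QuotientGroup.eq_one_iff c).2 (Subgroup.mem_subgroupOf.2
      ((mem_contCoboundaries_iff _).2 ⟨d₀, rfl⟩)), mul_one]
  · funext g
    show ε.coeffOf (f.1 (ε.pull g)) * _ =
      ε.coeffOf (f.1 (ε.pull g) * (MulAut.conjNormal (D.toTheta (ε.pull g : D.PiTemp)) d₀ * d₀⁻¹))
    rw [ε.coeffOf_mul, ε.coeffOf_mul, hinv, ← ε.act_coeffOf hC hS, ε.ι_pull]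
    rfl

/-- Every member of every class of an orbit collection `orbitColl S` (`η̈^{Θ,ℤ×μ₂}`, `η̈^{Θ,l·ℤ×μ₂}`, `η̈^{Θ,l·ℤ}` of the model)
stays in its class after multiplication by a coboundary. [cite: MochizukiEtTh2009, Def 2.7 p.41] -/
theorem mul_coboundary_mem_of_mem_orbitColl (hC : D.Compat) (hS : D.Sec2Hyps) (S : Set D.PiTemp) :
    ∀ c : Set (↥T.PiYddtp → (ThetaOrbitData.ofEmbedding ε hC hS).DeltaTheta), c ∈ ε.orbitColl hC S →
      ∀ η ∈ c, ∀ d : (ThetaOrbitData.ofEmbedding ε hC hS).DeltaTheta,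
      (fun g : ↥T.PiYddtp => η g * ((ThetaOrbitData.ofEmbedding ε hC hS).act (g : T.Gtp) d * d⁻¹)) ∈ c := by
  rintro c ⟨σ, -, rfl⟩ η hη d
  exact ε.mul_coboundary_mem_classOf hC hS hη d

/-- The same for the ROOT collections `rootColl S` (`η̲̈^{Θ,l·ℤ×μ₂}`, `η̲̈^{Θ,l·ℤ}`): `(ξ·∂d)^l = ξ^l · ∂(d^l)` (commutative
cyclotome), and `F·∂(d^l)` is again in the class. [cite: MochizukiEtTh2009, Def 2.7 p.41] -/
theorem mul_coboundary_mem_of_mem_rootColl (hC : D.Compat) (hS : D.Sec2Hyps) (S : Set D.PiTemp) :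
    ∀ c : Set (↥(T.PiYddtp ⊓ T.tp T.PiXuu) → (ThetaOrbitData.ofEmbedding ε hC hS).DeltaTheta),
      c ∈ ε.rootColl hC S → ∀ ξ ∈ c, ∀ d : (ThetaOrbitData.ofEmbedding ε hC hS).DeltaTheta,
      (fun g : ↥(T.PiYddtp ⊓ T.tp T.PiXuu) =>
        ξ g * ((ThetaOrbitData.ofEmbedding ε hC hS).act (g : T.Gtp) d * d⁻¹)) ∈ c := by
  letI : CommGroup (ThetaOrbitData.ofEmbedding ε hC hS).DeltaTheta :=
    { (inferInstance : Group (ThetaOrbitData.ofEmbedding ε hC hS).DeltaTheta) with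
      mul_comm := ThetaOrbitData.ofEmbedding_deltaTheta_comm ε hC hS }
  rintro c ⟨σ, -, rfl⟩ ξ ⟨F, hF, hpow⟩ d
  refine ⟨_, ε.mul_coboundary_mem_classOf hC hS hF (d ^ l), fun g => ?_⟩
  -- (computed inside the cyclotome of `ofEmbedding`; `F` is `ε.Coeff`-valued, the same type by `rfl`)
  have key : (ξ g * ((ThetaOrbitData.ofEmbedding ε hC hS).act (g : T.Gtp) d * d⁻¹)) ^ l =
      ξ g ^ l * ((ThetaOrbitData.ofEmbedding ε hC hS).act (g : T.Gtp) (d ^ l) * (d ^ l)⁻¹) := by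
    rw [mul_pow, mul_pow, ← map_pow, inv_pow]
  have hpow' : @Eq (ThetaOrbitData.ofEmbedding ε hC hS).DeltaTheta (ξ g ^ l) (F ⟨g, g.2.1⟩) := hpow g
  rw [hpow'] at key
  exact key

end ThetaSetting.EtaleThetaData.DoubleUnderline.OrbitEmbedding

namespace ThetaCovers.ThetaOrbitData

variable {p : ℕ} [Fact p.Prime] {D : ThetaSetting p} {E : D.EtaleThetaData} {l : ℕ}
  {C : E.DoubleUnderline l} {T : TemperedCoverData.{u} l} (ε : C.OrbitEmbedding T)

/-- **At the model, «order `1`» ⟺ equality, orbit collections**: for every conjugating set `S`,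
`EqUpToRootOfUnity 1 _ (orbitColl S) C′ ↔ C′ = orbitColl S`. [cite: MochizukiEtTh2009, Cor 2.8(i) p.42] -/
theorem ofEmbedding_eqUpToRootOfUnity_one_orbitColl_iff (hC : D.Compat) (hS : D.Sec2Hyps) (S : Set D.PiTemp)
    {C' : Set (Set (↥T.PiYddtp → (ofEmbedding ε hC hS).DeltaTheta))} :
    (ofEmbedding ε hC hS).EqUpToRootOfUnity 1 T.PiYddtp (ε.orbitColl hC S) C' ↔ C' = ε.orbitColl hC S :=
  ⟨fun h => h.eq_of_one (ofEmbedding_deltaTheta_comm ε hC hS) (ε.mul_coboundary_mem_of_mem_orbitColl hC hS S),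
    fun h => EqUpToRootOfUnity.of_eq h⟩

/-- **At the model, «order `1`» ⟺ equality, root collections**: for every conjugating set `S`,
`EqUpToRootOfUnity 1 _ (rootColl S) C′ ↔ C′ = rootColl S`. [cite: MochizukiEtTh2009, Cor 2.8(i) p.42] -/
theorem ofEmbedding_eqUpToRootOfUnity_one_rootColl_iff (hC : D.Compat) (hS : D.Sec2Hyps) (S : Set D.PiTemp)
    {C' : Set (Set (↥(T.PiYddtp ⊓ T.tp T.PiXuu) → (ofEmbedding ε hC hS).DeltaTheta))} :
    (ofEmbedding ε hC hS).EqUpToRootOfUnity 1 (T.PiYddtp ⊓ T.tp T.PiXuu) (ε.rootColl hC S) C' ↔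
      C' = ε.rootColl hC S :=
  ⟨fun h => h.eq_of_one (ofEmbedding_deltaTheta_comm ε hC hS) (ε.mul_coboundary_mem_of_mem_rootColl hC hS S),
    fun h => EqUpToRootOfUnity.of_eq h⟩

/-- **The five named collections of the model**: `η̈^{Θ,ℤ×μ₂}`, `η̈^{Θ,l·ℤ×μ₂}`, `η̈^{Θ,l·ℤ}`, `η̲̈^{Θ,l·ℤ×μ₂}`, `η̲̈^{Θ,l·ℤ}` are each
determined EXACTLY by «equality up to a root of unity of order `1`». [cite: MochizukiEtTh2009, Cor 2.8(i) p.42] -/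
theorem ofEmbedding_eqUpToRootOfUnity_one_iff (hC : D.Compat) (hS : D.Sec2Hyps) :
    (∀ C', (ofEmbedding ε hC hS).EqUpToRootOfUnity 1 _ (ofEmbedding ε hC hS).etaZMu2 C' ↔
      C' = (ofEmbedding ε hC hS).etaZMu2) ∧
    (∀ C', (ofEmbedding ε hC hS).EqUpToRootOfUnity 1 _ (ofEmbedding ε hC hS).etaLZMu2 C' ↔
      C' = (ofEmbedding ε hC hS).etaLZMu2) ∧
    (∀ C', (ofEmbedding ε hC hS).EqUpToRootOfUnity 1 _ (ofEmbedding ε hC hS).etaLZ C' ↔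
      C' = (ofEmbedding ε hC hS).etaLZ) ∧
    (∀ C', (ofEmbedding ε hC hS).EqUpToRootOfUnity 1 _ (ofEmbedding ε hC hS).rootLZMu2 C' ↔
      C' = (ofEmbedding ε hC hS).rootLZMu2) ∧
    (∀ C', (ofEmbedding ε hC hS).EqUpToRootOfUnity 1 _ (ofEmbedding ε hC hS).rootLZ C' ↔
      C' = (ofEmbedding ε hC hS).rootLZ) :=
  ⟨fun _ => ofEmbedding_eqUpToRootOfUnity_one_orbitColl_iff ε hC hS _,
    fun _ => ofEmbedding_eqUpToRootOfUnity_one_orbitColl_iff ε hC hS _,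
    fun _ => ofEmbedding_eqUpToRootOfUnity_one_orbitColl_iff ε hC hS _,
    fun _ => ofEmbedding_eqUpToRootOfUnity_one_rootColl_iff ε hC hS _,
    fun _ => ofEmbedding_eqUpToRootOfUnity_one_rootColl_iff ε hC hS _⟩

/-- **Conclusions C3/C4 of `Cor28_i` at the model say EXACTLY «preserved»**: for EVERY pair `(Γ, Γ_Θ)` (no `InducesOnTheta`,
no inner-ness) and every stability witness `hY` of `Π^tp_Ÿ`, «`Γ·η̈^{Θ,ℤ×μ₂}` equals `η̈^{Θ,ℤ×μ₂}` up to a root of unity of order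
`1`» ⟺ `Γ·η̈^{Θ,ℤ×μ₂} = η̈^{Θ,ℤ×μ₂}`, and likewise for `η̈^{Θ,l·ℤ×μ₂}` — the «resp. `1`» clauses of print coincide with the
exact-preservation shape of Cor 2.8 (iii). [cite: MochizukiEtTh2009, Cor 2.8(i) p.42] -/
theorem ofEmbedding_cor28_i_C3C4_iff_transport_eq (hC : D.Compat) (hS : D.Sec2Hyps) (Γ : T.Gtp ≃ₜ* T.Gtp)
    (ΓΘ : (ofEmbedding ε hC hS).DeltaTheta ≃* (ofEmbedding ε hC hS).DeltaTheta)
    (hY : T.PiYddtp.map Γ.toMulEquiv.toMonoidHom = T.PiYddtp) :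
    ((ofEmbedding ε hC hS).EqUpToRootOfUnity 1 _ (ofEmbedding ε hC hS).etaZMu2
        ((ofEmbedding ε hC hS).transport _ Γ hY ΓΘ (ofEmbedding ε hC hS).etaZMu2) ↔
      (ofEmbedding ε hC hS).transport _ Γ hY ΓΘ (ofEmbedding ε hC hS).etaZMu2 = (ofEmbedding ε hC hS).etaZMu2) ∧
    ((ofEmbedding ε hC hS).EqUpToRootOfUnity 1 _ (ofEmbedding ε hC hS).etaLZMu2
        ((ofEmbedding ε hC hS).transport _ Γ hY ΓΘ (ofEmbedding ε hC hS).etaLZMu2) ↔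
      (ofEmbedding ε hC hS).transport _ Γ hY ΓΘ (ofEmbedding ε hC hS).etaLZMu2 = (ofEmbedding ε hC hS).etaLZMu2) :=
  ⟨ofEmbedding_eqUpToRootOfUnity_one_orbitColl_iff ε hC hS _, ofEmbedding_eqUpToRootOfUnity_one_orbitColl_iff ε hC hS _⟩

/-! ## §3. Head-form instances for every INNER automorphism from `Π^tp_{X̲̲}` (orders `l`, `1`, `1`) -/

/-- **The three `EqUpToRootOfUnity` conclusions of `Cor28_i` (C2 order `l` on `η̲̈^{Θ,l·ℤ×μ₂}`; C3/C4 order `1` on `η̈^{Θ,ℤ×μ₂}`,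
`η̈^{Θ,l·ℤ×μ₂}`) HOLD at the model for every inner `γ_x`, `x ∈ Π^tp_{X̲̲}` of `T`, and every `Γ_Θ` it induces** — indeed the
transports are the collections themselves (abc-iut-L2-t2's `ofEmbedding_transport_inner_*`, Cor 2.8 (iii)), witness `κ = 1`;
no standard-type, `Dtau` or tower hypothesis. [cite: MochizukiEtTh2009, Cor 2.8(i) p.42] -/
theorem ofEmbedding_eqUpToRootOfUnity_innerAutTop (hC : D.Compat) (hS : D.Sec2Hyps) {x : T.Gtp} (hx : x ∈ T.tp T.PiXuu)
    (ΓΘ : (ofEmbedding ε hC hS).DeltaTheta ≃* (ofEmbedding ε hC hS).DeltaTheta)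
    (hind : (ofEmbedding ε hC hS).InducesOnTheta (innerAutTop x) ΓΘ)
    (hY : T.PiYddtp.map (innerAutTop x).toMulEquiv.toMonoidHom = T.PiYddtp)
    (hYuu : (T.PiYddtp ⊓ T.tp T.PiXuu).map (innerAutTop x).toMulEquiv.toMonoidHom = T.PiYddtp ⊓ T.tp T.PiXuu) :
    (ofEmbedding ε hC hS).EqUpToRootOfUnity l _ (ofEmbedding ε hC hS).rootLZMu2
        ((ofEmbedding ε hC hS).transport _ (innerAutTop x) hYuu ΓΘ (ofEmbedding ε hC hS).rootLZMu2) ∧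
      (ofEmbedding ε hC hS).EqUpToRootOfUnity 1 _ (ofEmbedding ε hC hS).etaZMu2
        ((ofEmbedding ε hC hS).transport _ (innerAutTop x) hY ΓΘ (ofEmbedding ε hC hS).etaZMu2) ∧
      (ofEmbedding ε hC hS).EqUpToRootOfUnity 1 _ (ofEmbedding ε hC hS).etaLZMu2
        ((ofEmbedding ε hC hS).transport _ (innerAutTop x) hY ΓΘ (ofEmbedding ε hC hS).etaLZMu2) := by
  have hxX : x ∈ (⊤ : Subgroup D.PiTemp).map ε.ι := Subgroup.map_mono le_top (ε.map_Huu.ge hx)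
  have hxXu : x ∈ (D.GtpXu l).map ε.ι := Subgroup.map_mono C.Huu_le_GtpXu (ε.map_Huu.ge hx)
  rw [ofEmbedding_transport_inner_etaZMu2 ε hC hS hxX ΓΘ hind hY,
    ofEmbedding_transport_inner_rootLZMu2 ε hC hS hx ΓΘ hind hYuu,
    ofEmbedding_transport_inner_etaLZMu2 ε hC hS hxXu ΓΘ hind hY]
  exact ⟨eqUpToRootOfUnity_refl _ _ _ _, eqUpToRootOfUnity_refl _ _ _ _, eqUpToRootOfUnity_refl _ _ _ _⟩

/-- **The same with the side data DISCHARGED**: for every `x ∈ Π^tp_{X̲̲}` of `T` the induced `Γ_Θ` (`= act x`,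
abc-iut-L2-t2's `exists_inducesOnTheta_innerAutTop`) and the stability witnesses of `Π^tp_Ÿ`, `Π^tp_{Ÿ̲̲}` EXIST, and the three
`EqUpToRootOfUnity` conclusions of `Cor28_i` hold for `(γ_x, Γ_Θ)`. [cite: MochizukiEtTh2009, Cor 2.8(i) p.42] -/
theorem ofEmbedding_exists_eqUpToRootOfUnity_innerAutTop (hC : D.Compat) (hS : D.Sec2Hyps) {x : T.Gtp}
    (hx : x ∈ T.tp T.PiXuu) :
    ∃ (ΓΘ : (ofEmbedding ε hC hS).DeltaTheta ≃* (ofEmbedding ε hC hS).DeltaTheta)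
      (hY : T.PiYddtp.map (innerAutTop x).toMulEquiv.toMonoidHom = T.PiYddtp)
      (hYuu : (T.PiYddtp ⊓ T.tp T.PiXuu).map (innerAutTop x).toMulEquiv.toMonoidHom = T.PiYddtp ⊓ T.tp T.PiXuu),
      (ofEmbedding ε hC hS).InducesOnTheta (innerAutTop x) ΓΘ ∧ (∀ a, ΓΘ a = (ofEmbedding ε hC hS).act x a) ∧
      (ofEmbedding ε hC hS).EqUpToRootOfUnity l _ (ofEmbedding ε hC hS).rootLZMu2
          ((ofEmbedding ε hC hS).transport _ (innerAutTop x) hYuu ΓΘ (ofEmbedding ε hC hS).rootLZMu2) ∧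
        (ofEmbedding ε hC hS).EqUpToRootOfUnity 1 _ (ofEmbedding ε hC hS).etaZMu2
          ((ofEmbedding ε hC hS).transport _ (innerAutTop x) hY ΓΘ (ofEmbedding ε hC hS).etaZMu2) ∧
        (ofEmbedding ε hC hS).EqUpToRootOfUnity 1 _ (ofEmbedding ε hC hS).etaLZMu2
          ((ofEmbedding ε hC hS).transport _ (innerAutTop x) hY ΓΘ (ofEmbedding ε hC hS).etaLZMu2) := by
  obtain ⟨ΓΘ, hind, hact⟩ := (ofEmbedding ε hC hS).exists_inducesOnTheta_innerAutTop x
  have hxX : x ∈ (⊤ : Subgroup D.PiTemp).map ε.ι := Subgroup.map_mono le_top (ε.map_Huu.ge hx)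
  exact ⟨ΓΘ, map_innerAutTop_PiYddtp ε hC hxX, map_innerAutTop_PiYdduu ε hC (ε.map_Huu.ge hx), hind, hact,
    ofEmbedding_eqUpToRootOfUnity_innerAutTop ε hC hS hx ΓΘ hind _ _⟩

end ThetaCovers.ThetaOrbitData

end Literature.AnabelianGeometry.EtaleTheta

end
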